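import Mathlib
import Literature.MathematicalPhysics.QuantumLattice.EuclideanAction

/-!
# LINES g11-1 «blind detector» / g11-2 «engine tori» (planner ym-idea-8 g11): Cauchy–Schwarz for the mirror pairing of a
MEASURABLE kernel — the `Measurable K` twin of `UniversalDetectorMirrorCauchySchwarz`

Shared analysis stub `BlindDetectorRigidity` of the supports `UniversalDetector.BlindDetector` (stmt-QuantumFields-24148)
and `FixedTorusFirst.SomeTorusDetector` (stmt-QuantumFields-24177).  The landed `DetectorRigidity.mirrorCauchySchwarz`
assumes `ContinuousOn K {z ≠ 0}` but uses it ONLY to obtain measurability of `K` (the supports of the two test functions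
are time-separated, so `K` is bounded where the integrand lives); here the hypothesis is `Measurable K` and the proof is
otherwise the landed one verbatim: for a kernel bounded away from the origin, even and time-reflection invariant, whose
mirror pairing `B(w₁,w₂) = ∫∫ (Θ w₁)(x) w₂(y) K(y - x) dx dy` is reflection positive on positive-slab Schwartz functions,
`B(w₁,w₁) = 0 → B(w₁,w₂) = 0` (Fubini, the change of variables `(x,y) ↦ (ϑy, ϑx)`, reflection positivity of
`w₁ + c w₂`, norm-free Cauchy–Schwarz).  No summit, rung or crux is proved here; NT and the YM mass gap are NOT proved.
[folklore]
-/

set_option autoImplicit false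

noncomputable section

open MeasureTheory Filter Set
open scoped Topology
open Literature.MathematicalPhysics.QuantumLattice

namespace Summit.QuantumFields.YangMills.Cruxes.BlindDetectorRigidity

/-- `|u₀| ≤ ‖u‖` on `ℝ⁴`. -/
private theorem abs_coord_le_norm'' (u : EuclideanSpace ℝ (Fin 4)) : |u 0| ≤ ‖u‖ := by
  have h := abs_real_inner_le_norm (EuclideanSpace.single (0 : Fin 4) (1 : ℝ)) u
  rw [EuclideanSpace.inner_single_left] at h
  simpa using h

/-- The time coordinate is continuous on `ℝ⁴`. -/
private theorem continuous_coord'' : Continuous fun y : EuclideanSpace ℝ (Fin 4) => y 0 :=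
  (EuclideanSpace.proj (0 : Fin 4) : EuclideanSpace ℝ (Fin 4) →L[ℝ] ℝ).continuous

/-- The positive time slab `{t ≤ y₀ ≤ T}` is closed. -/
private theorem isClosed_slab' (t T : ℝ) : IsClosed {y : EuclideanSpace ℝ (Fin 4) | t ≤ y 0 ∧ y 0 ≤ T} :=
  (isClosed_le continuous_const continuous_coord'').inter (isClosed_le continuous_coord'' continuous_const)

/-- Cauchy–Schwarz without a norm: a non-negative quadratic with vanishing constant term has no linear term. -/
private theorem eq_zero_of_quadratic_nonneg' {B C : ℝ} (h : ∀ c : ℝ, 0 ≤ 2 * c * B + c ^ 2 * C) : B = 0 := by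
  by_contra hB
  have hB2 : 0 < B ^ 2 := lt_of_le_of_ne (sq_nonneg B) (Ne.symm (pow_ne_zero 2 hB))
  rcases le_or_gt C 0 with hC | hC
  · have h1 := h (-B)
    nlinarith
  · have h1 := h (-B / C)
    have h2 : 2 * (-B / C) * B + (-B / C) ^ 2 * C = -(B ^ 2 / C) := by
      field_simp; ring
    rw [h2] at h1
    have h3 : 0 < B ^ 2 / C := div_pos hB2 hC
    linarith

/-- Time separation of the supports: if `Θu(x) ≠ 0` and `v(y) ≠ 0` for slab-supported `u, v`, then
`‖y - x‖ ≥ t_u + t_v`. -/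
private theorem slab_separation {u v : SchwartzMap (EuclideanSpace ℝ (Fin 4)) ℝ} {tu Tu tv Tv : ℝ}
    (hu : tsupport (u : EuclideanSpace ℝ (Fin 4) → ℝ) ⊆ {y | tu ≤ y 0 ∧ y 0 ≤ Tu})
    (hv : tsupport (v : EuclideanSpace ℝ (Fin 4) → ℝ) ⊆ {y | tv ≤ y 0 ∧ y 0 ≤ Tv})
    {x y : EuclideanSpace ℝ (Fin 4)} (hx : thetaTest 4 u x ≠ 0) (hy : v y ≠ 0) :
    tu + tv ≤ ‖y - x‖ := by
  rw [thetaTest_apply] at hx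
  have h1 := hu (subset_tsupport _ (Function.mem_support.mpr hx))
  have h2 := hv (subset_tsupport _ (Function.mem_support.mpr hy))
  simp only [mem_setOf_eq] at h2
  simp [timeReflection_apply] at h1
  calc tu + tv ≤ (y - x) 0 := by simp; linarith [h1.1, h2.1]
    _ ≤ |(y - x) 0| := le_abs_self _
    _ ≤ ‖y - x‖ := abs_coord_le_norm'' _

/-- The mirror-pairing integrand of two positive-slab Schwartz functions is integrable on `ℝ⁴ × ℝ⁴`. -/
private theorem pair_integrable {K : EuclideanSpace ℝ (Fin 4) → ℝ} (hKm : Measurable K)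
    (hb : ∀ η : ℝ, 0 < η → ∃ C : ℝ, ∀ z : EuclideanSpace ℝ (Fin 4), η ≤ ‖z‖ → |K z| ≤ C)
    {u v : SchwartzMap (EuclideanSpace ℝ (Fin 4)) ℝ} {tu Tu tv Tv : ℝ} (htu : 0 < tu) (htv : 0 < tv)
    (hu : tsupport (u : EuclideanSpace ℝ (Fin 4) → ℝ) ⊆ {y | tu ≤ y 0 ∧ y 0 ≤ Tu})
    (hv : tsupport (v : EuclideanSpace ℝ (Fin 4) → ℝ) ⊆ {y | tv ≤ y 0 ∧ y 0 ≤ Tv}) :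
    Integrable (fun z : EuclideanSpace ℝ (Fin 4) × EuclideanSpace ℝ (Fin 4) =>
        thetaTest 4 u z.1 * v z.2 * K (z.2 - z.1))
      ((volume : Measure (EuclideanSpace ℝ (Fin 4))).prod volume) := by
  obtain ⟨C, hC⟩ := hb (tu + tv) (by positivity)
  have hmeas : AEStronglyMeasurable (fun z : EuclideanSpace ℝ (Fin 4) × EuclideanSpace ℝ (Fin 4) =>
      thetaTest 4 u z.1 * v z.2 * K (z.2 - z.1)) ((volume : Measure (EuclideanSpace ℝ (Fin 4))).prod volume) :=
    ((((thetaTest 4 u).continuous.comp continuous_fst).mul (v.continuous.comp continuous_snd)).measurable.mul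
      (hKm.comp (measurable_snd.sub measurable_fst))).aestronglyMeasurable
  have hdom : Integrable (fun z : EuclideanSpace ℝ (Fin 4) × EuclideanSpace ℝ (Fin 4) =>
      max C 0 * (‖thetaTest 4 u z.1‖ * ‖v z.2‖)) ((volume : Measure (EuclideanSpace ℝ (Fin 4))).prod volume) :=
    ((thetaTest 4 u).integrable.norm.mul_prod v.integrable.norm).const_mul _
  refine hdom.mono' hmeas (Eventually.of_forall fun z => ?_)
  rw [Real.norm_eq_abs, abs_mul, abs_mul, Real.norm_eq_abs, Real.norm_eq_abs]
  by_cases h1 : thetaTest 4 u z.1 = 0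
  · simp [h1]
  by_cases h2 : v z.2 = 0
  · simp [h2]
  have hK : |K (z.2 - z.1)| ≤ max C 0 := (hC _ (slab_separation hu hv h1 h2)).trans (le_max_left _ _)
  calc |thetaTest 4 u z.1| * |v z.2| * |K (z.2 - z.1)|
      ≤ |thetaTest 4 u z.1| * |v z.2| * max C 0 := by gcongr
    _ = max C 0 * (|thetaTest 4 u z.1| * |v z.2|) := by ring

/-- The mirror pairing as one integral over `ℝ⁴ × ℝ⁴` (Fubini). -/
private theorem pair_eq_prod {K : EuclideanSpace ℝ (Fin 4) → ℝ} (hKm : Measurable K)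
    (hb : ∀ η : ℝ, 0 < η → ∃ C : ℝ, ∀ z : EuclideanSpace ℝ (Fin 4), η ≤ ‖z‖ → |K z| ≤ C)
    {u v : SchwartzMap (EuclideanSpace ℝ (Fin 4)) ℝ} {tu Tu tv Tv : ℝ} (htu : 0 < tu) (htv : 0 < tv)
    (hu : tsupport (u : EuclideanSpace ℝ (Fin 4) → ℝ) ⊆ {y | tu ≤ y 0 ∧ y 0 ≤ Tu})
    (hv : tsupport (v : EuclideanSpace ℝ (Fin 4) → ℝ) ⊆ {y | tv ≤ y 0 ∧ y 0 ≤ Tv}) :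
    (∫ x, ∫ y, thetaTest 4 u x * v y * K (y - x)) =
      ∫ z : EuclideanSpace ℝ (Fin 4) × EuclideanSpace ℝ (Fin 4), thetaTest 4 u z.1 * v z.2 * K (z.2 - z.1) := by
  rw [Measure.volume_eq_prod, integral_prod _ (pair_integrable hKm hb htu htv hu hv)]

/-- Symmetry of the mirror pairing (change of variables `(x, y) ↦ (ϑy, ϑx)`, `K` even and `ϑ`-invariant). -/
private theorem pair_symm {K : EuclideanSpace ℝ (Fin 4) → ℝ}
    (he : ∀ z : EuclideanSpace ℝ (Fin 4), K (-z) = K z)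
    (hθ : ∀ z : EuclideanSpace ℝ (Fin 4), K (timeReflection 4 z) = K z)
    (u v : SchwartzMap (EuclideanSpace ℝ (Fin 4)) ℝ) :
    (∫ z : EuclideanSpace ℝ (Fin 4) × EuclideanSpace ℝ (Fin 4), thetaTest 4 v z.1 * u z.2 * K (z.2 - z.1)) =
      ∫ z : EuclideanSpace ℝ (Fin 4) × EuclideanSpace ℝ (Fin 4), thetaTest 4 u z.1 * v z.2 * K (z.2 - z.1) := by
  set θm : EuclideanSpace ℝ (Fin 4) ≃ᵐ EuclideanSpace ℝ (Fin 4) :=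
    (timeReflection 4).toHomeomorph.toMeasurableEquiv with hθm_def
  set Ψ : EuclideanSpace ℝ (Fin 4) × EuclideanSpace ℝ (Fin 4) ≃ᵐ
      EuclideanSpace ℝ (Fin 4) × EuclideanSpace ℝ (Fin 4) :=
    MeasurableEquiv.prodComm.trans (θm.prodCongr θm) with hΨ_def
  have hΨ : MeasurePreserving Ψ ((volume : Measure (EuclideanSpace ℝ (Fin 4))).prod volume)
      ((volume : Measure (EuclideanSpace ℝ (Fin 4))).prod volume) :=
    (((timeReflection 4).measurePreserving).prod (timeReflection 4).measurePreserving).comp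
      Measure.measurePreserving_swap
  have h := hΨ.integral_comp'
    (fun z : EuclideanSpace ℝ (Fin 4) × EuclideanSpace ℝ (Fin 4) => thetaTest 4 u z.1 * v z.2 * K (z.2 - z.1))
  rw [← Measure.volume_eq_prod] at h
  rw [← h]
  refine integral_congr_ae (Eventually.of_forall fun z => ?_)
  have hΨz : Ψ z = (timeReflection 4 z.2, timeReflection 4 z.1) := rfl
  simp only [hΨz, thetaTest_apply, timeReflection_timeReflection]
  rw [← map_sub, hθ, ← he (z.2 - z.1), neg_sub]
  ring

/-- The support of `w₁ + c • w₂` sits inside the union of the supports. -/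
private theorem tsupport_add_smul_subset (w₁ w₂ : SchwartzMap (EuclideanSpace ℝ (Fin 4)) ℝ) (c : ℝ) :
    tsupport ((w₁ + c • w₂ : SchwartzMap (EuclideanSpace ℝ (Fin 4)) ℝ) : EuclideanSpace ℝ (Fin 4) → ℝ) ⊆
      tsupport (w₁ : EuclideanSpace ℝ (Fin 4) → ℝ) ∪ tsupport (w₂ : EuclideanSpace ℝ (Fin 4) → ℝ) := by
  have hs : Function.support ((w₁ + c • w₂ : SchwartzMap (EuclideanSpace ℝ (Fin 4)) ℝ) :
      EuclideanSpace ℝ (Fin 4) → ℝ) ⊆ Function.support (w₁ : EuclideanSpace ℝ (Fin 4) → ℝ) ∪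
        Function.support (w₂ : EuclideanSpace ℝ (Fin 4) → ℝ) := by
    intro x hx
    by_contra h'
    simp only [Set.mem_union, Function.mem_support, not_or, not_not] at h'
    exact hx (by simp [h'.1, h'.2])
  simpa only [tsupport, closure_union] using closure_mono hs

/-- **Cauchy–Schwarz for the mirror pairing of a measurable kernel** (the `hcs` input of the blind semigroup-kill
step): `B(w₁,w₁) = 0 → B(w₁,w₂) = 0` for positive-slab Schwartz functions. [folklore] -/
theorem blindMirrorCauchySchwarz :
    ∀ (K : EuclideanSpace ℝ (Fin 4) → ℝ),
      Measurable K →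
      (∀ η : ℝ, 0 < η → ∃ C : ℝ, ∀ z : EuclideanSpace ℝ (Fin 4), η ≤ ‖z‖ → |K z| ≤ C) →
      (∀ z : EuclideanSpace ℝ (Fin 4), K (-z) = K z) →
      (∀ z : EuclideanSpace ℝ (Fin 4), K (timeReflection 4 z) = K z) →
      (∀ (w : SchwartzMap (EuclideanSpace ℝ (Fin 4)) ℝ) (t₀ T : ℝ), 0 < t₀ →
        tsupport (w : EuclideanSpace ℝ (Fin 4) → ℝ) ⊆ {y | t₀ ≤ y 0 ∧ y 0 ≤ T} →
        0 ≤ ∫ x, ∫ y, (thetaTest 4 w) x * w y * K (y - x)) →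
      ∀ (w₁ w₂ : SchwartzMap (EuclideanSpace ℝ (Fin 4)) ℝ) (t₁ T₁ t₂ T₂ : ℝ),
        0 < t₁ → tsupport (w₁ : EuclideanSpace ℝ (Fin 4) → ℝ) ⊆ {y | t₁ ≤ y 0 ∧ y 0 ≤ T₁} →
        0 < t₂ → tsupport (w₂ : EuclideanSpace ℝ (Fin 4) → ℝ) ⊆ {y | t₂ ≤ y 0 ∧ y 0 ≤ T₂} →
        (∫ x, ∫ y, (thetaTest 4 w₁) x * w₁ y * K (y - x)) = 0 →
        (∫ x, ∫ y, (thetaTest 4 w₁) x * w₂ y * K (y - x)) = 0 := by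
  intro K hKm hb he hθ hrp w₁ w₂ t₁ T₁ t₂ T₂ ht₁ hs₁ ht₂ hs₂ hB11
  -- the four pairings as integrals over `ℝ⁴ × ℝ⁴`
  have i11 := pair_integrable hKm hb ht₁ ht₁ hs₁ hs₁
  have i12 := pair_integrable hKm hb ht₁ ht₂ hs₁ hs₂
  have i21 := pair_integrable hKm hb ht₂ ht₁ hs₂ hs₁
  have i22 := pair_integrable hKm hb ht₂ ht₂ hs₂ hs₂
  rw [← Measure.volume_eq_prod] at i11 i12 i21 i22
  rw [pair_eq_prod hKm hb ht₁ ht₁ hs₁ hs₁] at hB11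
  rw [pair_eq_prod hKm hb ht₁ ht₂ hs₁ hs₂]
  -- the slab of `w₁ + c • w₂`
  have ht : 0 < min t₁ t₂ := lt_min ht₁ ht₂
  have hsupp : ∀ c : ℝ, tsupport ((w₁ + c • w₂ : SchwartzMap (EuclideanSpace ℝ (Fin 4)) ℝ) :
      EuclideanSpace ℝ (Fin 4) → ℝ) ⊆ {y | min t₁ t₂ ≤ y 0 ∧ y 0 ≤ max T₁ T₂} := by
    intro c y hy
    rcases tsupport_add_smul_subset w₁ w₂ c hy with h | h
    · have h' := hs₁ h
      exact ⟨(min_le_left _ _).trans h'.1, h'.2.trans (le_max_left _ _)⟩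
    · have h' := hs₂ h
      exact ⟨(min_le_right _ _).trans h'.1, h'.2.trans (le_max_right _ _)⟩
  -- reflection positivity along the line, expanded
  apply eq_zero_of_quadratic_nonneg'
    (C := ∫ z : EuclideanSpace ℝ (Fin 4) × EuclideanSpace ℝ (Fin 4), thetaTest 4 w₂ z.1 * w₂ z.2 * K (z.2 - z.1))
  intro c
  have h0 := hrp (w₁ + c • w₂) (min t₁ t₂) (max T₁ T₂) ht (hsupp c)
  rw [pair_eq_prod hKm hb ht ht (hsupp c) (hsupp c)] at h0
  have e : ∀ z : EuclideanSpace ℝ (Fin 4) × EuclideanSpace ℝ (Fin 4),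
      thetaTest 4 (w₁ + c • w₂) z.1 * (w₁ + c • w₂) z.2 * K (z.2 - z.1) =
        (thetaTest 4 w₁ z.1 * w₁ z.2 * K (z.2 - z.1) + c * (thetaTest 4 w₁ z.1 * w₂ z.2 * K (z.2 - z.1))) +
          (c * (thetaTest 4 w₂ z.1 * w₁ z.2 * K (z.2 - z.1)) +
            c ^ 2 * (thetaTest 4 w₂ z.1 * w₂ z.2 * K (z.2 - z.1))) := by
    intro z
    simp only [thetaTest_apply, add_apply, smul_apply, smul_eq_mul]
    ring
  simp_rw [e] at h0
  have j1 : Integrable (fun z : EuclideanSpace ℝ (Fin 4) × EuclideanSpace ℝ (Fin 4) =>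
      thetaTest 4 w₁ z.1 * w₁ z.2 * K (z.2 - z.1) + c * (thetaTest 4 w₁ z.1 * w₂ z.2 * K (z.2 - z.1))) :=
    i11.add (i12.const_mul c)
  have j2 : Integrable (fun z : EuclideanSpace ℝ (Fin 4) × EuclideanSpace ℝ (Fin 4) =>
      c * (thetaTest 4 w₂ z.1 * w₁ z.2 * K (z.2 - z.1)) +
        c ^ 2 * (thetaTest 4 w₂ z.1 * w₂ z.2 * K (z.2 - z.1))) :=
    (i21.const_mul c).add (i22.const_mul (c ^ 2))
  have j3 : Integrable (fun z : EuclideanSpace ℝ (Fin 4) × EuclideanSpace ℝ (Fin 4) =>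
      c * (thetaTest 4 w₁ z.1 * w₂ z.2 * K (z.2 - z.1))) := i12.const_mul c
  have j4 : Integrable (fun z : EuclideanSpace ℝ (Fin 4) × EuclideanSpace ℝ (Fin 4) =>
      c * (thetaTest 4 w₂ z.1 * w₁ z.2 * K (z.2 - z.1))) := i21.const_mul c
  have j5 : Integrable (fun z : EuclideanSpace ℝ (Fin 4) × EuclideanSpace ℝ (Fin 4) =>
      c ^ 2 * (thetaTest 4 w₂ z.1 * w₂ z.2 * K (z.2 - z.1))) := i22.const_mul (c ^ 2)
  rw [integral_add j1 j2, integral_add i11 j3, integral_add j4 j5, integral_const_mul, integral_const_mul,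
    integral_const_mul, hB11, pair_symm he hθ w₁ w₂] at h0
  linarith

end Summit.QuantumFields.YangMills.Cruxes.BlindDetectorRigidity

end
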